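import Mathlib

/-!
# Area-law slaving, complex part 7 — the RELATIVE DERIVATIVE BOUND of the continued core area (near and far mechanisms)
# (`FilamentSkeletonRss`, child crux `TangentSkeletonNearStraight`, stmt-NavierStokesRegularity-28295, line
# `child_tangent_analytic_strip`, ∃-side of the registered stub `stub_analyticClosing`: the `StadiumAnalyticArea` conjunct)

Complex part 6 (`Theorems.AreaLawSlavingHolo.stadium_window_of_relative_deriv_bound`) reduced the factor-two window
`Aa(Re z)/2 ≤ Re G(z)`, `‖G(z)‖ ≤ 2·Aa(Re z)` of `StadiumAnalyticArea` to a RELATIVE derivative bound `‖G′(ζ)‖ ≤ κ·Aa(Re ζ)` for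
the holomorphic solution `G` of the complexified area law `w·G′ = (3/2 − w′)·G + 4` (complex part 4, `areaLaw_holo`).  This file
proves the two mechanisms that give such a bound, with explicit constants:

* `areaLaw_deriv_at_zero` — AT the zero `c` of the slip: `(2w′(c) − 3/2)·G′(c) = −w″(c)·G(c)` (differentiate the law at `c`);
* `areaLaw_deriv_bound_near` — NEAR the zero (the regular singular point): on any compact convex `V ∋ c` inside the domain with
  `V ⊆ B̄(c, r)`, `‖w″‖ ≤ K₂` on `V` and `K₂·r ≤ 1/4`, one has `‖G′‖ ≤ (4/3)·K₂·‖G(c)‖` on `V`.  Mechanism (no Frobenius series):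
  the numerator `N = (3/2 − w′)G + 4` vanishes at `c` (regularity condition `G(c) = 4/(w′(c) − 3/2)`), so at a maximiser `z⋆` of
  `‖G′‖` on `V` the identity `G′ = N/w` and the mean-value bounds `‖N(z)‖ ≤ ‖z − c‖·sup_V ‖N′‖`, `‖w(z)‖ ≥ (w′(c) − K₂r)·‖z − c‖`
  give `M′·(3/2 − 3K₂r) ≤ K₂‖G(c)‖` for `M′ = max_V ‖G′‖` — the bootstrap closes because the exponent ratio
  `(w′(c) − 3/2)/w′(c)` of the singular point is `< 1`;
* `areaLaw_norm_bound_far`, `areaLaw_deriv_bound_far` — FAR from the zero: along the vertical segment from the real foot, where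
  the slip has a floor `‖w‖ ≥ μ > 0` and `‖3/2 − w′‖ ≤ Λ′`, Grönwall gives
  `‖G(z)‖ ≤ ‖G(Re z)‖·e^{Λ′|Im z|/μ} + (4/Λ′)(e^{Λ′|Im z|/μ} − 1)` and `‖G′(z)‖ ≤ (Λ′‖G(z)‖ + 4)/μ`.

The assembly on the thin stadium (both regimes + part 6) is complex part 8.

HONEST FRAMING: classical ODE/complex analysis serving a HYPOTHETICAL filament skeleton on the NEGATIVE side of a MODEL route; no
registered stub is closed by this file and nothing here bears on Navier–Stokes regularity or blow-up.
`--supports stmt-NavierStokesRegularity-28295`.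
-/

set_option linter.dupNamespace false

noncomputable section

namespace Summit.NavierStokesRegularity.NavierStokesRegularity.Theorems.AreaLawSlavingHolo

open Set Metric Filter Real
open scoped Topology

/-! ## §1 The derivative of the continued area at the singular point -/

/-- **At the zero.**  `U` open, `w, G` holomorphic on `U` with `w·G′ = (3/2 − w′)·G + 4` on `U`, `c ∈ U`, `w c = 0`.  Then
`(2·w′(c) − 3/2)·G′(c) = −w″(c)·G(c)`. [folklore] -/
theorem areaLaw_deriv_at_zero {U : Set ℂ} (hUo : IsOpen U) {w G : ℂ → ℂ} (hw : DifferentiableOn ℂ w U)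
    (hG : DifferentiableOn ℂ G U) (hode : ∀ z ∈ U, w z * deriv G z = (3 / 2 - deriv w z) * G z + 4)
    {c : ℂ} (hc : c ∈ U) (hwc : w c = 0) :
    (2 * deriv w c - 3 / 2) * deriv G c = -(deriv (deriv w) c * G c) := by
  have hw' : DifferentiableOn ℂ (deriv w) U := (hw.analyticOnNhd hUo).deriv.differentiableOn
  have hG' : DifferentiableOn ℂ (deriv G) U := (hG.analyticOnNhd hUo).deriv.differentiableOn
  have hUc : U ∈ 𝓝 c := hUo.mem_nhds hc
  have hL : HasDerivAt (fun z => w z * deriv G z) (deriv w c * deriv G c + w c * deriv (deriv G) c) c :=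
    ((hw.differentiableAt hUc).hasDerivAt).mul ((hG'.differentiableAt hUc).hasDerivAt)
  have hR : HasDerivAt (fun z => (3 / 2 - deriv w z) * G z + 4)
      ((0 - deriv (deriv w) c) * G c + (3 / 2 - deriv w c) * deriv G c) c :=
    ((((hasDerivAt_const c (3 / 2 : ℂ)).sub ((hw'.differentiableAt hUc).hasDerivAt)).mul
      ((hG.differentiableAt hUc).hasDerivAt)).add_const 4)
  have heq : (fun z => (3 / 2 - deriv w z) * G z + 4) =ᶠ[𝓝 c] (fun z => w z * deriv G z) :=
    Filter.eventually_of_mem hUc (fun z hz => (hode z hz).symm)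
  have h := (hL.congr_of_eventuallyEq heq).unique hR
  rw [hwc, zero_mul, add_zero] at h
  linear_combination h

/-! ## §2 Near the zero: the bootstrap at the regular singular point -/

/-- **Relative derivative bound NEAR the zero.**  `U` open; `V ⊆ U` compact convex with `↑c ∈ V ⊆ B̄(c, r)`; `w, G` holomorphic on
`U` with the complex area law on `U`; `w c = 0`, `w′(c)` real and `> 3/2`, `G(c) = 4/(w′(c) − 3/2)` (the regular value);
`‖w″‖ ≤ K₂` on `V` and `K₂·r ≤ 1/4`.  Then `‖G′(z)‖ ≤ (4/3)·K₂·‖G(c)‖` for every `z ∈ V`. [folklore] -/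
theorem areaLaw_deriv_bound_near {U : Set ℂ} (hUo : IsOpen U) {V : Set ℂ} (hVU : V ⊆ U) (hVc : Convex ℝ V)
    (hVK : IsCompact V) {c : ℝ} (hcV : (c : ℂ) ∈ V) {r : ℝ} (hVr : ∀ z ∈ V, ‖z - c‖ ≤ r)
    {w G : ℂ → ℂ} (hw : DifferentiableOn ℂ w U) (hG : DifferentiableOn ℂ G U)
    (hode : ∀ z ∈ U, w z * deriv G z = (3 / 2 - deriv w z) * G z + 4)
    (hwc : w c = 0) (hwc_im : (deriv w c).im = 0) (hwc_re : 3 / 2 < (deriv w c).re)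
    (hGc : G c = 4 / (deriv w c - 3 / 2))
    {K₂ : ℝ} (hK₂ : ∀ ζ ∈ V, ‖deriv (deriv w) ζ‖ ≤ K₂) (hK₂r : K₂ * r ≤ 1 / 4) :
    ∀ z ∈ V, ‖deriv G z‖ ≤ 4 / 3 * K₂ * ‖G c‖ := by
  set d : ℝ := (deriv w c).re with hd
  have hwc' : deriv w c = (d : ℂ) := by
    apply Complex.ext <;> simp [hd, hwc_im]
  have hK₂nn : 0 ≤ K₂ := le_trans (norm_nonneg _) (hK₂ c hcV)
  have hrnn : 0 ≤ r := le_trans (norm_nonneg _) (hVr c hcV)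
  -- differentiability at the points of `V`
  have hwA : AnalyticOnNhd ℂ w U := hw.analyticOnNhd hUo
  have hGA : AnalyticOnNhd ℂ G U := hG.analyticOnNhd hUo
  have hwD : ∀ z ∈ V, DifferentiableAt ℂ w z := fun z hz => hw.differentiableAt (hUo.mem_nhds (hVU hz))
  have hw'D : ∀ z ∈ V, DifferentiableAt ℂ (deriv w) z := fun z hz =>
    hwA.deriv.differentiableOn.differentiableAt (hUo.mem_nhds (hVU hz))
  have hGD : ∀ z ∈ V, DifferentiableAt ℂ G z := fun z hz => hG.differentiableAt (hUo.mem_nhds (hVU hz))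
  have hG'D : ∀ z ∈ V, DifferentiableAt ℂ (deriv G) z := fun z hz =>
    hGA.deriv.differentiableOn.differentiableAt (hUo.mem_nhds (hVU hz))
  -- the maximum `M'` of `‖G′‖` on `V`
  have hG'cont : ContinuousOn (deriv G) V := fun z hz => (hG'D z hz).continuousAt.continuousWithinAt
  obtain ⟨zs, hzsV, hzsmax⟩ := hVK.exists_isMaxOn ⟨(c : ℂ), hcV⟩ (continuous_norm.comp_continuousOn hG'cont)
  set M' : ℝ := ‖deriv G zs‖ with hM'
  have hM'bd : ∀ z ∈ V, ‖deriv G z‖ ≤ M' := fun z hz => hzsmax hz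
  have hM'nn : 0 ≤ M' := norm_nonneg _
  -- (1) `‖w′ ζ − w′ c‖ ≤ K₂ ‖ζ − c‖` on `V`
  have h1 : ∀ ζ ∈ V, ‖deriv w ζ - deriv w c‖ ≤ K₂ * ‖ζ - c‖ := fun ζ hζ =>
    hVc.norm_image_sub_le_of_norm_deriv_le hw'D hK₂ hcV hζ
  -- (2) `‖3/2 − w′ ζ‖ ≤ (d − 3/2) + K₂ r` on `V`
  have hac : ‖(3 / 2 : ℂ) - deriv w c‖ = d - 3 / 2 := by
    rw [hwc', show (3 / 2 : ℂ) - (d : ℂ) = ((3 / 2 - d : ℝ) : ℂ) by push_cast; ring, Complex.norm_real,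
      Real.norm_eq_abs, abs_of_nonpos (by linarith)]
    ring
  have h2 : ∀ ζ ∈ V, ‖(3 / 2 : ℂ) - deriv w ζ‖ ≤ (d - 3 / 2) + K₂ * r := by
    intro ζ hζ
    have hK : ‖deriv w ζ - deriv w c‖ ≤ K₂ * r :=
      (h1 ζ hζ).trans (mul_le_mul_of_nonneg_left (hVr ζ hζ) hK₂nn)
    calc ‖(3 / 2 : ℂ) - deriv w ζ‖ = ‖((3 / 2 : ℂ) - deriv w c) - (deriv w ζ - deriv w c)‖ := by ring_nf
      _ ≤ ‖(3 / 2 : ℂ) - deriv w c‖ + ‖deriv w ζ - deriv w c‖ := norm_sub_le _ _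
      _ ≤ (d - 3 / 2) + K₂ * r := by rw [hac]; linarith [hK]
  -- (3) `‖G ζ‖ ≤ ‖G c‖ + r M'` on `V`
  have h3 : ∀ ζ ∈ V, ‖G ζ‖ ≤ ‖G c‖ + r * M' := by
    intro ζ hζ
    have hK : ‖G ζ - G c‖ ≤ M' * r :=
      (hVc.norm_image_sub_le_of_norm_deriv_le hGD hM'bd hcV hζ).trans (mul_le_mul_of_nonneg_left (hVr ζ hζ) hM'nn)
    calc ‖G ζ‖ = ‖G c + (G ζ - G c)‖ := by congr 1; ring
      _ ≤ ‖G c‖ + ‖G ζ - G c‖ := norm_add_le _ _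
      _ ≤ ‖G c‖ + r * M' := by linarith [hK]
  -- (4) the numerator `N = (3/2 − w′)·G + 4`, `N c = 0`, and `‖N′‖ ≤ B` on `V`
  set N : ℂ → ℂ := fun z => (3 / 2 - deriv w z) * G z + 4 with hN
  have hdc : deriv w c - 3 / 2 ≠ 0 := by
    rw [hwc']; intro h
    have h' := congrArg Complex.re h
    simp at h'; linarith
  have hNc : N c = 0 := by
    simp only [hN, hGc, div_eq_mul_inv]
    have hinv : (deriv w c - 3 / 2) * (deriv w c - 3 / 2)⁻¹ = 1 := mul_inv_cancel₀ hdc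
    linear_combination (-4) * hinv
  have hN'at : ∀ ζ ∈ V, HasDerivAt N (-(deriv (deriv w) ζ) * G ζ + (3 / 2 - deriv w ζ) * deriv G ζ) ζ := by
    intro ζ hζ
    have h : HasDerivAt (fun z => (3 / 2 - deriv w z) * G z + 4)
        ((0 - deriv (deriv w) ζ) * G ζ + (3 / 2 - deriv w ζ) * deriv G ζ) ζ :=
      ((((hasDerivAt_const ζ (3 / 2 : ℂ)).sub (hw'D ζ hζ).hasDerivAt).mul (hGD ζ hζ).hasDerivAt).add_const
        (4 : ℂ))
    exact h.congr_deriv (by ring)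
  have hND : ∀ ζ ∈ V, DifferentiableAt ℂ N ζ := fun ζ hζ => (hN'at ζ hζ).differentiableAt
  set B : ℝ := K₂ * (‖G c‖ + r * M') + ((d - 3 / 2) + K₂ * r) * M' with hB
  have hN'bd : ∀ ζ ∈ V, ‖deriv N ζ‖ ≤ B := by
    intro ζ hζ
    rw [(hN'at ζ hζ).deriv]
    calc ‖-(deriv (deriv w) ζ) * G ζ + (3 / 2 - deriv w ζ) * deriv G ζ‖
        ≤ ‖-(deriv (deriv w) ζ) * G ζ‖ + ‖(3 / 2 - deriv w ζ) * deriv G ζ‖ := norm_add_le _ _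
      _ = ‖deriv (deriv w) ζ‖ * ‖G ζ‖ + ‖(3 / 2 : ℂ) - deriv w ζ‖ * ‖deriv G ζ‖ := by
          rw [norm_mul, norm_mul, norm_neg]
      _ ≤ K₂ * (‖G c‖ + r * M') + ((d - 3 / 2) + K₂ * r) * M' :=
          add_le_add (mul_le_mul (hK₂ ζ hζ) (h3 ζ hζ) (norm_nonneg _) hK₂nn)
            (mul_le_mul (h2 ζ hζ) (hM'bd ζ hζ) (norm_nonneg _) (by linarith [mul_nonneg hK₂nn hrnn]))
  -- (5) `‖N z‖ ≤ B ‖z − c‖` on `V`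
  have h5 : ∀ z ∈ V, ‖N z‖ ≤ B * ‖z - c‖ := by
    intro z hz
    have h := hVc.norm_image_sub_le_of_norm_deriv_le hND hN'bd hcV hz
    rwa [hNc, sub_zero] at h
  -- (6) the slip from below: `(d − K₂ r)‖z − c‖ ≤ ‖w z‖` on `V`
  have h6 : ∀ z ∈ V, (d - K₂ * r) * ‖z - c‖ ≤ ‖w z‖ := by
    intro z hz
    set f : ℂ → ℂ := fun ζ => w ζ - (ζ - c) * deriv w c with hf
    have hf'at : ∀ ζ ∈ V, HasDerivAt f (deriv w ζ - deriv w c) ζ := by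
      intro ζ hζ
      have h : HasDerivAt (fun ζ => w ζ - (ζ - c) * deriv w c) (deriv w ζ - 1 * deriv w c) ζ :=
        (hwD ζ hζ).hasDerivAt.sub (((hasDerivAt_id ζ).sub_const (c : ℂ)).mul_const (deriv w c))
      exact h.congr_deriv (by ring)
    have hfD : ∀ ζ ∈ V, DifferentiableAt ℂ f ζ := fun ζ hζ => (hf'at ζ hζ).differentiableAt
    have hf'bd : ∀ ζ ∈ V, ‖deriv f ζ‖ ≤ K₂ * r := by
      intro ζ hζ
      rw [(hf'at ζ hζ).deriv]
      exact (h1 ζ hζ).trans (mul_le_mul_of_nonneg_left (hVr ζ hζ) hK₂nn)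
    have h := hVc.norm_image_sub_le_of_norm_deriv_le hfD hf'bd hcV hz
    have hfc : f c = 0 := by simp [hf, hwc]
    rw [hfc, sub_zero] at h
    have hnorm : ‖(z - c) * deriv w c‖ = ‖z - (c : ℂ)‖ * d := by
      rw [norm_mul, hwc', Complex.norm_real, Real.norm_eq_abs, abs_of_pos (by linarith)]
    have hsplit : (z - c) * deriv w c = w z - f z := by simp [hf]
    calc (d - K₂ * r) * ‖z - c‖ = ‖z - (c : ℂ)‖ * d - K₂ * r * ‖z - c‖ := by ring
      _ ≤ ‖(z - c) * deriv w c‖ - ‖f z‖ := by rw [hnorm]; linarith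
      _ ≤ ‖w z‖ := by rw [hsplit]; linarith [norm_sub_le (w z) (f z)]
  -- (7) the bootstrap at the maximiser
  have hkey : M' ≤ 4 / 3 * K₂ * ‖G c‖ := by
    by_cases hzc : zs = (c : ℂ)
    · -- the maximiser is the zero itself
      have hat := areaLaw_deriv_at_zero hUo hw hG hode (hVU hcV) hwc
      have hn : ‖(2 * deriv w (c : ℂ) - 3 / 2)‖ * ‖deriv G c‖ = ‖deriv (deriv w) c‖ * ‖G c‖ := by
        rw [← norm_mul, hat, norm_neg, norm_mul]
      have hcoef : ‖(2 * deriv w (c : ℂ) - 3 / 2)‖ = 2 * d - 3 / 2 := by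
        rw [hwc', show (2 : ℂ) * (d : ℂ) - 3 / 2 = ((2 * d - 3 / 2 : ℝ) : ℂ) by push_cast; ring, Complex.norm_real,
          Real.norm_eq_abs, abs_of_pos (by linarith)]
      have hineq : (2 * d - 3 / 2) * ‖deriv G (c : ℂ)‖ ≤ K₂ * ‖G c‖ := by
        rw [← hcoef, hn]; exact mul_le_mul_of_nonneg_right (hK₂ c hcV) (norm_nonneg _)
      rw [hM', hzc]
      have hG'nn := norm_nonneg (deriv G (c : ℂ))
      have hGnn := norm_nonneg (G c)
      nlinarith [mul_nonneg hK₂nn hGnn, mul_nonneg (show (0:ℝ) ≤ 2 * d - 3 by linarith) hG'nn]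
    · -- the maximiser is off the zero: divide the identity `w·G′ = N` by `‖zs − c‖ > 0`
      have hpos : 0 < ‖zs - c‖ := norm_pos_iff.mpr (sub_ne_zero.mpr hzc)
      have hNz : ‖w zs‖ * M' = ‖N zs‖ := by rw [hM', ← norm_mul, hode zs (hVU hzsV)]
      have hchain : (d - K₂ * r) * ‖zs - c‖ * M' ≤ B * ‖zs - c‖ := by
        calc (d - K₂ * r) * ‖zs - c‖ * M' ≤ ‖w zs‖ * M' := mul_le_mul_of_nonneg_right (h6 zs hzsV) hM'nn
          _ = ‖N zs‖ := hNz
          _ ≤ B * ‖zs - c‖ := h5 zs hzsV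
      have h' : (d - K₂ * r) * M' ≤ B := by
        have h'' : ((d - K₂ * r) * M') * ‖zs - c‖ ≤ B * ‖zs - c‖ := by
          calc ((d - K₂ * r) * M') * ‖zs - c‖ = (d - K₂ * r) * ‖zs - c‖ * M' := by ring
            _ ≤ B * ‖zs - c‖ := hchain
        exact le_of_mul_le_mul_right h'' hpos
      -- `M'(3/2 − 3K₂r) ≤ K₂‖G c‖` and `3/2 − 3K₂r ≥ 3/4`
      have h8 : M' * (3 / 2 - 3 * (K₂ * r)) ≤ K₂ * ‖G c‖ := by rw [hB] at h'; nlinarith [h']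
      have h9 : M' * (3 / 4) ≤ M' * (3 / 2 - 3 * (K₂ * r)) := mul_le_mul_of_nonneg_left (by linarith) hM'nn
      nlinarith [h8, h9, mul_nonneg hK₂nn (norm_nonneg (G c))]
  intro z hz
  exact (hM'bd z hz).trans hkey

/-! ## §3 Far from the zero: vertical Grönwall under a slip floor -/

/-- **Modulus bound FAR from the zero.**  `U` open convex; `w, G` holomorphic on `U` with the complex area law; `z ∈ U` with real
foot `↑(Re z) ∈ U`; along the vertical segment from the foot to `z`: `‖w‖ ≥ μ > 0` and `‖3/2 − w′‖ ≤ Λ′` (`Λ′ > 0`).  Then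
`‖G z‖ ≤ ‖G(Re z)‖·e^{Λ′|Im z|/μ} + (4/Λ′)·(e^{Λ′|Im z|/μ} − 1)`. [folklore: Grönwall] -/
theorem areaLaw_norm_bound_far {U : Set ℂ} (hUo : IsOpen U) (hUc : Convex ℝ U) {w G : ℂ → ℂ}
    (hG : DifferentiableOn ℂ G U) (hode : ∀ z ∈ U, w z * deriv G z = (3 / 2 - deriv w z) * G z + 4)
    {z : ℂ} (hz : z ∈ U) (hfoot : ((z.re : ℝ) : ℂ) ∈ U) {μ Λ' : ℝ} (hμ : 0 < μ) (hΛ' : 0 < Λ')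
    (hfloor : ∀ t ∈ Icc (0:ℝ) 1, μ ≤ ‖w ((z.re : ℂ) + (t : ℂ) * (z - z.re))‖)
    (hΛ'bd : ∀ t ∈ Icc (0:ℝ) 1, ‖(3 / 2 : ℂ) - deriv w ((z.re : ℂ) + (t : ℂ) * (z - z.re))‖ ≤ Λ') :
    ‖G z‖ ≤ ‖G (z.re : ℂ)‖ * exp (Λ' * |z.im| / μ) + 4 / Λ' * (exp (Λ' * |z.im| / μ) - 1) := by
  set a : ℂ := (z.re : ℂ) with ha
  set v : ℂ := z - a with hv
  have hv_norm : ‖v‖ = |z.im| := by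
    have h : z - (z.re : ℂ) = (z.im : ℂ) * Complex.I := by apply Complex.ext <;> simp
    rw [hv, ha, h, norm_mul, Complex.norm_I, mul_one, Complex.norm_real, Real.norm_eq_abs]
  have hseg : ∀ t ∈ Icc (0:ℝ) 1, a + (t : ℂ) * v ∈ U := by
    intro t ht
    have h := hUc.add_smul_sub_mem hfoot hz ht
    simpa [hv, ha, Complex.real_smul] using h
  -- the path `f t = G (a + t v)` and its derivative
  set f : ℝ → ℂ := fun t => G (a + (t : ℂ) * v) with hf
  set f' : ℝ → ℂ := fun t => deriv G (a + (t : ℂ) * v) * v with hf'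
  have hfd : ∀ t ∈ Icc (0:ℝ) 1, HasDerivAt f (f' t) t := by
    intro t ht
    have h1 : HasDerivAt G (deriv G (a + (t : ℂ) * v)) (a + (t : ℂ) * v) :=
      (hG.differentiableAt (hUo.mem_nhds (hseg t ht))).hasDerivAt
    have h2 : HasDerivAt (fun u : ℂ => a + u * v) v (t : ℂ) := by
      simpa using ((hasDerivAt_id (t : ℂ)).mul_const v).const_add a
    have h3 : HasDerivAt (fun u : ℂ => G (a + u * v)) (deriv G (a + (t : ℂ) * v) * v) (t : ℂ) := h1.comp (t : ℂ) h2
    exact h3.comp_ofReal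
  have hfc : ContinuousOn f (Icc (0:ℝ) 1) := fun t ht => (hfd t ht).continuousAt.continuousWithinAt
  have hfw : ∀ t ∈ Ico (0:ℝ) 1, HasDerivWithinAt f (f' t) (Ici t) t := fun t ht =>
    (hfd t (Ico_subset_Icc_self ht)).hasDerivWithinAt
  -- the differential inequality `‖f′‖ ≤ (Λ′|Im z|/μ)‖f‖ + 4|Im z|/μ`
  have hbound : ∀ t ∈ Ico (0:ℝ) 1, ‖f' t‖ ≤ Λ' * |z.im| / μ * ‖f t‖ + 4 * |z.im| / μ := by
    intro t ht
    have ht' : t ∈ Icc (0:ℝ) 1 := Ico_subset_Icc_self ht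
    obtain ⟨ζ, hζ⟩ : ∃ ζ : ℂ, ζ = a + (t : ℂ) * v := ⟨_, rfl⟩
    have hζU : ζ ∈ U := hζ ▸ hseg t ht'
    have hft : f t = G ζ := by rw [hf, hζ]
    have hf't : f' t = deriv G ζ * v := by rw [hf', hζ]
    have hwζ : μ ≤ ‖w ζ‖ := hζ ▸ hfloor t ht'
    have hwζpos : 0 < ‖w ζ‖ := lt_of_lt_of_le hμ hwζ
    have hG'ζ : ‖deriv G ζ‖ * ‖w ζ‖ ≤ Λ' * ‖G ζ‖ + 4 := by
      calc ‖deriv G ζ‖ * ‖w ζ‖ = ‖w ζ * deriv G ζ‖ := by rw [norm_mul, mul_comm]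
        _ = ‖(3 / 2 - deriv w ζ) * G ζ + 4‖ := by rw [hode ζ hζU]
        _ ≤ ‖(3 / 2 - deriv w ζ) * G ζ‖ + ‖(4 : ℂ)‖ := norm_add_le _ _
        _ = ‖(3 / 2 : ℂ) - deriv w ζ‖ * ‖G ζ‖ + 4 := by rw [norm_mul]; norm_num
        _ ≤ Λ' * ‖G ζ‖ + 4 := by
            linarith [mul_le_mul_of_nonneg_right (hζ ▸ hΛ'bd t ht' : ‖(3 / 2 : ℂ) - deriv w ζ‖ ≤ Λ')
              (norm_nonneg (G ζ))]
    have hG'ζ' : ‖deriv G ζ‖ ≤ (Λ' * ‖G ζ‖ + 4) / μ := by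
      rw [le_div_iff₀ hμ]
      exact (mul_le_mul_of_nonneg_left hwζ (norm_nonneg _)).trans hG'ζ
    calc ‖f' t‖ = ‖deriv G ζ‖ * |z.im| := by rw [hf't, norm_mul, hv_norm]
      _ ≤ (Λ' * ‖G ζ‖ + 4) / μ * |z.im| := mul_le_mul_of_nonneg_right hG'ζ' (abs_nonneg _)
      _ = Λ' * |z.im| / μ * ‖f t‖ + 4 * |z.im| / μ := by rw [hft]; ring
  have hgr := norm_le_gronwallBound_of_norm_deriv_right_le hfc hfw (le_rfl : ‖f 0‖ ≤ ‖f 0‖) hbound 1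
    ⟨zero_le_one, le_rfl⟩
  have hf0 : f 0 = G (z.re : ℂ) := by simp [hf, ha]
  have hf1 : f 1 = G z := by simp [hf, hv]
  rw [hf1, hf0, sub_zero] at hgr
  -- evaluate the Grönwall bound
  by_cases him : z.im = 0
  · have hK : Λ' * |z.im| / μ = 0 := by rw [him]; simp
    rw [hK, gronwallBound_K0] at hgr
    rw [him]; simp only [abs_zero, mul_zero, zero_div, exp_zero, mul_one, sub_self, add_zero]
    simpa [him] using hgr
  · have hK : Λ' * |z.im| / μ ≠ 0 := by
      have : 0 < |z.im| := abs_pos.mpr him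
      positivity
    rw [gronwallBound_of_K_ne_0 hK] at hgr
    simp only [mul_one] at hgr
    have hεK : 4 * |z.im| / μ / (Λ' * |z.im| / μ) = 4 / Λ' := by
      have : 0 < |z.im| := abs_pos.mpr him
      field_simp
    rw [hεK] at hgr
    exact hgr

/-- **Derivative bound FAR from the zero.**  Under the complex area law at a point `z` where `‖w z‖ ≥ μ > 0` and
`‖3/2 − w′ z‖ ≤ Λ′`: `‖G′ z‖ ≤ (Λ′‖G z‖ + 4)/μ`. [folklore] -/
theorem areaLaw_deriv_bound_far {w G : ℂ → ℂ} {z : ℂ} (hode : w z * deriv G z = (3 / 2 - deriv w z) * G z + 4)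
    {μ Λ' : ℝ} (hμ : 0 < μ) (hfloor : μ ≤ ‖w z‖) (hΛ'bd : ‖(3 / 2 : ℂ) - deriv w z‖ ≤ Λ') :
    ‖deriv G z‖ ≤ (Λ' * ‖G z‖ + 4) / μ := by
  have h : ‖deriv G z‖ * ‖w z‖ ≤ Λ' * ‖G z‖ + 4 := by
    calc ‖deriv G z‖ * ‖w z‖ = ‖w z * deriv G z‖ := by rw [norm_mul, mul_comm]
      _ = ‖(3 / 2 - deriv w z) * G z + 4‖ := by rw [hode]
      _ ≤ ‖(3 / 2 - deriv w z) * G z‖ + ‖(4 : ℂ)‖ := norm_add_le _ _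
      _ = ‖(3 / 2 : ℂ) - deriv w z‖ * ‖G z‖ + 4 := by rw [norm_mul]; norm_num
      _ ≤ Λ' * ‖G z‖ + 4 := by linarith [mul_le_mul_of_nonneg_right hΛ'bd (norm_nonneg (G z))]
  rw [le_div_iff₀ hμ]
  exact (mul_le_mul_of_nonneg_left hfloor (norm_nonneg _)).trans h

end Summit.NavierStokesRegularity.NavierStokesRegularity.Theorems.AreaLawSlavingHolo
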